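import Literature.NumberTheory.Automorphic.CuspidalRepGL2Exists
import Literature.NumberTheory.Automorphic.CuspidalRepDataOfCuspForm
import Literature.NumberTheory.Automorphic.JacquetLanglandsParts
import Literature.NumberTheory.Automorphic.QuaternionAlgebraExistence
import Literature.NumberTheory.Automorphic.QuaternionAlgebraAdelicRamificationProofs
import Literature.NumberTheory.Automorphic.QuaternionAlgebraAdelicMatrixProofs
import Literature.NumberTheory.Automorphic.QuaternionAlgebraStructure
import Literature.NumberTheory.Automorphic.QuaternionAlgebraClassification
import Literature.NumberTheory.Automorphic.QuaternionUnitsSpectrumDiscrete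
import Literature.NumberTheory.Automorphic.AdelicGroupDataQuotientClosed
import Literature.NumberTheory.Automorphic.QuaternionAlgebraAdelicInputs
import Literature.NumberTheory.Automorphic.AdelicGroupDataAutomorphicMeasureProofs
import Literature.NumberTheory.QuadraticForms.HilbertSymbolNonDyadic
import HarnessLib

/-!
# Cusp forms on `GL₂(𝔸_F)` for every number field `F`, from the Jacquet–Langlands transfer

Topic `NumberTheory/Automorphic`; namespace `Literature.NumberTheory.Automorphic`. Proof-only
sibling (theorems only: no definition, **no named fact**, no instance) of `CuspidalRepGL2Exists`,
whose named fact `nonempty_cuspidalAutomorphicRepData_two` (Gelbart (1975), Thm. 7.11: for every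
number field `F`, `CuspidalAutomorphicRepData 2 F hF` is inhabited — a cuspidal automorphic
representation of `GL₂(𝔸_F)` exists) is reduced here to the tree's named fact
`jacquetLanglands_transfer_exists K D` (`JacquetLanglandsParts`; Gelbart (1975), Thm. 10.5 (i);
Jacquet–Langlands (1970), Thm. 14.4):

* `nonempty_cuspidalAutomorphicRepData_two_of_jacquetLanglands` —
  **`(∀ K D, jacquetLanglands_transfer_exists K D) → nonempty_cuspidalAutomorphicRepData_two`.**

Gelbart proves Thm. 7.11 (the Hecke–Maaß–Shalika–Tanaka forms `π(λ)` attached to a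
Grössencharakter `λ ≠ μ ∘ N_{L/F}` of a quadratic extension `L/F`) through the local and global
Weil representation attached to `(L, N_{L/F})` (§7.A, (7.3)–(7.6); Prop. 7.8), the identity of
`L`-functions `L(s, χ ⊗ π(λ)) = L(s, λχ)` (Lemma 7.9), Hecke's theory for `L(s, λχ)` (Lemma 7.10)
and the converse theorem Thm. 6.18 (= Jacquet–Langlands Thm. 11.3); the constructive variant
(pp. 97–99) is Shalika–Tanaka's theta series for the global Weil representation. None of this
vocabulary (Weil representation, converse theorem) is in the tree, and the same book obtains cusp
forms on `GL₂` a second way, from the compact quotient of a division quaternion algebra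
(§10, Thm. 10.5 (i), used on pp. 157–158) — the Jacquet–Langlands transfer, which the tree carries
as the named fact `jacquetLanglands_transfer_exists` (with its own reduction layers
`JacquetLanglandsTransfer`, `…ExistsOfTraceComparison`, …). This file supplies, with proof,
everything else that second road needs:

1. `exists_isQuaternionAlgebra_forall_isUnit` — **every number field `K` carries a division
   quaternion algebra**: `ℍ[K,π,b]` for a non-dyadic prime `v`, a uniformiser `π` at `v` and a
   non-square `b` modulo `v` has Hilbert symbol `(π, b)_v = -1` (O'Meara 63:12, the tree's
   `QuadraticForms.hilbertSymbol_uniformizer_mul_iff`), so it is not split at `v`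
   (`isSplitAt_quaternionAlgebra_iff_hilbertSymbol_eq_one`) and hence, by Wedderburn, a division
   algebra (`IsQuaternionAlgebra.forall_isUnit_of_not_isSplitAt`, using `isSplitAt_matrix`);
   Vignéras, LNM 800, Ch. III §3.
2. `exists_discreteAutomorphicRep_not_isOneDimensional` — **for a division quaternion algebra `D`
   and an automorphic measure on `D_𝔸ˣ ⧸ ℝ_{>0} Dˣ`, some irreducible closed invariant subspace of
   `L²` has dimension `≠ 1`** (the "greater than one dimensional" constituents of Gelbart's `R'`,
   p. 149; non-vacuity of the transfer's hypothesis). Soft proof from theorems of the tree: `L²` is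
   the closed span of its irreducible closed subspaces (`isDiscretelyDecomposable_rightRegular_units`,
   Gelfand–Graev–Piatetski-Shapiro on the compact quotient, Fujisaki); were they all lines, all
   `R(g)` would commute (`ContRepresentation.commute_of_isDiscretelyDecomposable_of_finrank_eq_one`),
   so every commutator `c` of `D_𝔸ˣ` would act trivially on `L²`
   (`AdelicGroupData.rightRegular_commutator_eq_one`), hence on the compact Hausdorff quotient
   (`AdelicGroupData.smul_eq_self_of_rightRegular_eq_one`: Urysohn + `Continuous.ae_eq_iff_eq`),
   hence `c ∈ ℝ_{>0} · Dˣ`; but `c = e_∞ ⊗ κ + e_f ⊗ 1` with `κ` a non-central commutator of `Dˣ`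
   (`exists_commutator_units_not_central`) is not of that shape
   (`exists_commutator_not_mem_quotientSubgroup_units`, read in coordinates `𝔸_K ⊗ D ≃ 𝔸_K⁴`).
3. the assembly, through `exists_isAutomorphicMeasure_units_of_isUnit`,
   `exists_isAutomorphicMeasure_gl_holds` (Borel–Harish-Chandra) and
   `CuspidalAutomorphicRepData.ofL2` (Borel–Jacquet 4.6: the smooth vectors of an irreducible
   `Π ≤ L²_cusp` form a cuspidal automorphic representation datum).

So `nonempty_cuspidalAutomorphicRepData_two_holds` is one line once
`jacquetLanglands_transfer_exists` is discharged; nothing here weakens or restates either fact.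

## References

* S. Gelbart, *Automorphic Forms on Adele Groups*, Ann. of Math. Studies 83 (1975): §7.A–B
  (Prop. 7.8, Lemmas 7.9–7.10, Thm. 7.11, pp. 94–99 of the held text), §10 (Thm. 10.5, pp. 148–149;
  pp. 157–158). [Gelbart1975]
* H. Jacquet, R. P. Langlands, *Automorphic Forms on GL(2)*, LNM 114 (1970), Thm. 11.3, §12,
  Thm. 14.4. [JacquetLanglands1970]
* M.-F. Vignéras, *Arithmétique des algèbres de quaternions*, LNM 800 (1980), Ch. I §1–2, Ch. III
  §1–3. [VignerasLNM800]
* O. T. O'Meara, *Introduction to quadratic forms* (1963), §63 (63:12). [Omeara1963]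
* A. Borel, H. Jacquet, *Automorphic forms and automorphic representations*, Corvallis (1979), 4.6.
  [BorelJacquet1979]
-/

noncomputable section

open scoped Quaternion TensorProduct NNReal
open NumberField IsDedekindDomain MeasureTheory

universe u

namespace Literature.NumberTheory.Automorphic

/-! ### 1. Every number field carries a division quaternion algebra -/

section Division

variable (K : Type) [Field K] [NumberField K]

/-- A number field has a non-dyadic finite place: only the finitely many primes above `2` are
dyadic, and there are infinitely many primes. [folklore] -/
theorem exists_heightOneSpectrum_two_not_mem :
    ∃ v : HeightOneSpectrum (𝓞 K), (2 : 𝓞 K) ∉ v.asIdeal := by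
  haveI := infinite_heightOneSpectrum K
  have h2 : Ideal.span {(2 : 𝓞 K)} ≠ ⊥ := by
    rw [Ne, Ideal.span_singleton_eq_bot]
    exact two_ne_zero
  have hfin : {v : HeightOneSpectrum (𝓞 K) | (2 : 𝓞 K) ∈ v.asIdeal}.Finite := by
    refine (Ideal.finite_factors h2).subset ?_
    intro v hv
    exact Ideal.dvd_span_singleton.mpr hv
  obtain ⟨v, hv⟩ := hfin.infinite_compl.nonempty
  exact ⟨v, hv⟩

/-- At a non-dyadic prime `v` of `𝓞 K` some residue class is not a square (the residue field is a
finite field of odd characteristic, Mathlib `FiniteField.exists_nonsquare`); a representative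
`b ∈ 𝓞 K` is then prime to `v`. [folklore] -/
theorem exists_not_isSquare_residue_ringOfIntegers (v : HeightOneSpectrum (𝓞 K))
    (h2 : (2 : 𝓞 K) ∉ v.asIdeal) :
    ∃ b : 𝓞 K, b ∉ v.asIdeal ∧ ¬ IsSquare (Ideal.Quotient.mk v.asIdeal b) := by
  haveI : v.asIdeal.IsMaximal := v.isMaximal
  letI : Field (𝓞 K ⧸ v.asIdeal) := Ideal.Quotient.field v.asIdeal
  haveI : Finite (𝓞 K ⧸ v.asIdeal) := Ideal.finiteQuotientOfFreeOfNeBot v.asIdeal v.ne_bot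
  letI : Fintype (𝓞 K ⧸ v.asIdeal) := Fintype.ofFinite _
  have hchar : ringChar (𝓞 K ⧸ v.asIdeal) ≠ 2 := by
    intro h
    apply h2
    rw [← Ideal.Quotient.eq_zero_iff_mem, map_ofNat]
    have h' : ((2 : ℕ) : 𝓞 K ⧸ v.asIdeal) = 0 := by
      rw [ringChar.spec, h]
    exact_mod_cast h'
  obtain ⟨a, ha⟩ := FiniteField.exists_nonsquare hchar
  obtain ⟨b, rfl⟩ := Ideal.Quotient.mk_surjective a
  refine ⟨b, fun hb => ha ?_, ha⟩
  rw [Ideal.Quotient.eq_zero_iff_mem.mpr hb]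
  exact IsSquare.zero

variable {K} in
/-- A quaternion algebra over a number field which is **not split at some finite place is a
division algebra**: by Wedderburn (Mathlib `IsSimpleRing.exists_algEquiv_matrix_divisionRing_finite`)
a central simple algebra of dimension `4` is either a division algebra or `M₂(K)`, and `M₂(K)` is
split everywhere (`isSplitAt_matrix`). Vignéras, LNM 800, Ch. I §1–2 (Cor. 2.4) and Ch. III §3.
[cite: VignerasLNM800, Ch. III §3] -/
theorem IsQuaternionAlgebra.forall_isUnit_of_not_isSplitAt {D : Type*} [Ring D] [Algebra K D]
    [IsQuaternionAlgebra K D] {v : HeightOneSpectrum (𝓞 K)} (hv : ¬ IsSplitAt D v) :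
    ∀ x : D, x ≠ 0 → IsUnit x := by
  haveI := IsQuaternionAlgebra.isSimpleRing' K D
  have h4 := IsQuaternionAlgebra.finrank_eq_four (K := K) (D := D)
  haveI : IsArtinianRing D := IsArtinianRing.of_finite K D
  obtain ⟨n, hn, D', _, _, _, ⟨e⟩⟩ := IsSimpleRing.exists_algEquiv_matrix_divisionRing_finite K D
  have hdim : 4 = n * n * Module.finrank K D' := by
    rw [← h4, e.toLinearEquiv.finrank_eq, Module.finrank_matrix, Fintype.card_fin]
  have hpos : 0 < Module.finrank K D' := Module.finrank_pos
  have hn2 : n ≤ 2 := by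
    by_contra! h
    have : 3 * 3 * 1 ≤ n * n * Module.finrank K D' :=
      Nat.mul_le_mul (Nat.mul_le_mul h h) hpos
    omega
  interval_cases n
  · simp at hdim
  · -- `n = 1`: `D ≃ M₁(D')` is a division algebra
    have key : ∀ M : Matrix (Fin 1) (Fin 1) D', M ≠ 0 → IsUnit M := fun M hM ↦ by
      have h00 : M 0 0 ≠ 0 := fun h ↦ hM <| by
        ext i j; fin_cases i; fin_cases j; simpa using h
      refine isUnit_iff_exists.mpr ⟨Matrix.of fun _ _ ↦ (M 0 0)⁻¹, ?_, ?_⟩ <;>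
      · ext i j; fin_cases i; fin_cases j; simp [Matrix.mul_apply, h00]
    exact fun x hx ↦ by simpa using (key (e x) (by simpa using hx)).map e.symm
  · -- `n = 2`: `D ≃ M₂(K)` would be split at `v`
    exfalso
    have h1 : Module.finrank K D' = 1 := by omega
    let eK : K ≃ₐ[K] D' :=
      AlgEquiv.ofBijective (Algebra.ofId K D') (Module.Free.bijective_algebraMap_of_finrank_eq_one h1)
    exact hv (IsSplitAt.of_algEquiv K D (e.trans eK.symm.mapMatrix) v (isSplitAt_matrix K v))

/-- **Every number field `K` carries a division quaternion algebra** (Vignéras, LNM 800, Ch. III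
§3, Thm. 3.1; here the elementary instance only): for a non-dyadic prime `v`, a uniformiser
`π ∈ 𝓞 K` at `v` and `b ∈ 𝓞 K` a non-square modulo `v`, the Hilbert symbol `(π, b)_v` is `-1`
(O'Meara 63:12, the tree's `hilbertSymbol_uniformizer_mul_iff`), so `ℍ[K,π,b]` is not split at
`v` (`isSplitAt_quaternionAlgebra_iff_hilbertSymbol_eq_one`), hence is a division algebra
(`IsQuaternionAlgebra.forall_isUnit_of_not_isSplitAt`). [cite: VignerasLNM800, Ch. III §3 Thm. 3.1] -/
theorem exists_isQuaternionAlgebra_forall_isUnit :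
    ∃ (D : Type) (_ : Ring D) (_ : Algebra K D),
      IsQuaternionAlgebra K D ∧ ∀ x : D, x ≠ 0 → IsUnit x := by
  obtain ⟨v, h2⟩ := exists_heightOneSpectrum_two_not_mem K
  obtain ⟨b, hbv, hbsq⟩ := exists_not_isSquare_residue_ringOfIntegers K v h2
  obtain ⟨π, hπ⟩ := v.intValuation_exists_uniformizer
  have hπ0 : (π : K) ≠ 0 := by
    intro h0
    have hπ0' : π = 0 := by exact_mod_cast h0
    rw [hπ0', map_zero] at hπ
    exact WithZero.zero_ne_coe hπ
  have hb0 : (b : K) ≠ 0 := by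
    intro h0
    have hb0' : b = 0 := by exact_mod_cast h0
    exact hbv (hb0' ▸ v.asIdeal.zero_mem)
  have h1v : (1 : 𝓞 K) ∉ v.asIdeal := fun h ↦ v.isPrime.ne_top ((Ideal.eq_top_iff_one _).2 h)
  have hsymb : QuadraticForms.hilbertSymbol (v.adicCompletion K) (algebraMap K _ (π : K))
      (algebraMap K _ (b : K)) ≠ 1 := by
    intro hs
    apply hbsq
    have e1 : ∀ r : 𝓞 K, algebraMap (𝓞 K) (v.adicCompletion K) r =
        algebraMap K (v.adicCompletion K) (r : K) := fun r ↦ by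
      rw [IsScalarTower.algebraMap_apply (𝓞 K) K (v.adicCompletion K), RingOfIntegers.coe_eq_algebraMap]
    refine (QuadraticForms.hilbertSymbol_uniformizer_mul_iff K v h2 hπ h1v hbv).1 ?_
    rw [mul_one]
    convert hs using 2 <;> exact e1 _
  refine ⟨ℍ[K,(π : K),(b : K)], inferInstance, inferInstance,
    QuaternionAlgebra.isQuaternionAlgebra_holds hπ0 hb0, ?_⟩
  haveI := QuaternionAlgebra.isQuaternionAlgebra_holds (K := K) hπ0 hb0
  have hns : ¬ IsSplitAt ℍ[K,(π : K),(b : K)] v := by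
    rw [isSplitAt_quaternionAlgebra_iff_hilbertSymbol_eq_one K hπ0 hb0 v]
    exact hsymb
  exact IsQuaternionAlgebra.forall_isUnit_of_not_isSplitAt (K := K) hns

end Division

/-! ### 2. A division quaternion algebra has an automorphic representation of dimension `≠ 1` -/

section Algebra

/-- In a ring all of whose non-zero elements are units and which is not commutative, some
commutator `u w u⁻¹ w⁻¹` of two units is **not central**: if `x y ≠ y x` and both
`κ₁ = [x, y]` and `κ₂ = [x, y + 1]` were central, then from `x y x⁻¹ = κ₁ y` and
`x (y + 1) x⁻¹ = κ₂ (y + 1)` one gets `(κ₁ - κ₂) y = κ₂ - 1`, whence either `κ₁ = κ₂ = 1` or `y`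
is central — both contradict `x y ≠ y x`. [folklore] -/
theorem exists_commutator_units_not_central {D : Type*} [Ring D]
    (hdiv : ∀ x : D, x ≠ 0 → IsUnit x) {x y : D} (hxy : x * y ≠ y * x) :
    ∃ u w : Dˣ, ∃ z : D, z * ↑(u * w * u⁻¹ * w⁻¹) ≠ ↑(u * w * u⁻¹ * w⁻¹) * z := by
  have hx0 : x ≠ 0 := by rintro rfl; simp at hxy
  have hy0 : y ≠ 0 := by rintro rfl; simp at hxy
  have hy1 : y + 1 ≠ 0 := fun h ↦ by
    have : y = -1 := eq_neg_of_add_eq_zero_left h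
    apply hxy
    rw [this, mul_neg, neg_mul, mul_one, one_mul]
  obtain ⟨u, rfl⟩ := hdiv x hx0
  obtain ⟨w, rfl⟩ := hdiv _ hy0
  obtain ⟨w', hw'⟩ := hdiv _ hy1
  by_contra hall
  push Not at hall
  -- `hall : ∀ u w z, z * [u, w] = [u, w] * z`
  set κ₁ : Dˣ := u * w * u⁻¹ * w⁻¹ with hκ₁
  set κ₂ : Dˣ := u * w' * u⁻¹ * w'⁻¹ with hκ₂
  have c1 : ∀ z : D, z * κ₁ = κ₁ * z := hall u w
  have c2 : ∀ z : D, z * κ₂ = κ₂ * z := hall u w'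
  have e1 : (u : D) * w * ↑u⁻¹ = κ₁ * w := by
    rw [hκ₁]; push_cast; rw [Units.inv_mul_cancel_right]
  have e2 : (u : D) * w' * ↑u⁻¹ = κ₂ * w' := by
    rw [hκ₂]; push_cast; rw [Units.inv_mul_cancel_right]
  -- `κ₁ w + 1 = κ₂ w + κ₂`
  have e3 : (κ₁ : D) * w + 1 = κ₂ * w + κ₂ := by
    have h := e2
    rw [hw', mul_add, add_mul, mul_one, Units.mul_inv, e1, mul_add, mul_one] at h
    exact h
  by_cases h12 : (κ₁ : D) = κ₂
  · -- then `κ₂ = 1 = κ₁`, so `u w = w u`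
    rw [h12] at e3
    have hκ2 : (κ₂ : D) = 1 := (add_left_cancel e3).symm
    have hκ1 : κ₁ = 1 := Units.ext (h12.trans hκ2)
    apply hxy
    have : u * w = w * u := by
      have h := hκ1
      rw [hκ₁, mul_inv_eq_one, mul_inv_eq_iff_eq_mul] at h
      exact h
    exact_mod_cast congrArg Units.val this
  · -- `d = κ₁ - κ₂ ≠ 0` is central and `d w = κ₂ - 1`, so `w` is central
    have e4 : ((κ₁ : D) - κ₂) * w = κ₂ - 1 := by
      rw [sub_mul, sub_eq_sub_iff_add_eq_add, e3, add_comm]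
    have hd0 : (κ₁ : D) - κ₂ ≠ 0 := sub_ne_zero.2 h12
    obtain ⟨d, hd⟩ := hdiv _ hd0
    have cd : ∀ z : D, z * d = d * z := fun z ↦ by rw [hd, mul_sub, sub_mul, c1, c2]
    have cdi : ∀ z : D, z * ↑d⁻¹ = ↑d⁻¹ * z := fun z ↦ by
      calc z * ↑d⁻¹ = ↑d⁻¹ * (d * z) * ↑d⁻¹ := by rw [Units.inv_mul_cancel_left]
        _ = ↑d⁻¹ * (z * d) * ↑d⁻¹ := by rw [cd]
        _ = ↑d⁻¹ * z := by rw [mul_assoc, Units.mul_inv_cancel_right]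
    have hw : (w : D) = ↑d⁻¹ * (κ₂ - 1) := by
      rw [← e4, ← hd, ← mul_assoc, Units.inv_mul, one_mul]
    have cw : ∀ z : D, z * w = w * z := fun z ↦ by
      rw [hw, ← mul_assoc, cdi, mul_assoc, mul_assoc, mul_sub, sub_mul, mul_one, one_mul, c2]
    exact hxy (cw u)

end Algebra

section Adelic

variable (K : Type) [Field K] [NumberField K] (D : Type u) [Ring D] [Algebra K D]

omit [NumberField K] in
/-- Coordinates of a pure tensor `a ⊗ d ∈ R ⊗_K D` in the basis `Module.finBasis K D`:
`a` times the coordinates of `d` (`ScalarExtension.coordLinearEquiv_incl`). [folklore] -/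
theorem ScalarExtension.coordLinearEquiv_ofTensor_tmul {R : Type*} [CommRing R] [Algebra K R]
    [TopologicalSpace R] [IsTopologicalRing R] [Module.Finite K D] (a : R) (d : D)
    (i : Fin (Module.finrank K D)) :
    ScalarExtension.coordLinearEquiv K R D (ScalarExtension.ofTensor K R D (a ⊗ₜ[K] d)) i =
      a * algebraMap K R ((Module.finBasis K D).repr d i) := by
  have h : ScalarExtension.ofTensor K R D (a ⊗ₜ[K] d) = a • ScalarExtension.incl K R D d := by
    rw [ScalarExtension.incl_apply, ← map_smul, TensorProduct.smul_tmul', smul_eq_mul, mul_one]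
  rw [h, map_smul, Pi.smul_apply, smul_eq_mul, ScalarExtension.coordLinearEquiv_incl]

variable [IsQuaternionAlgebra K D]

/-- **A commutator in `D_𝔸ˣ` outside `ℝ_{>0} · Dˣ`.** For a division quaternion algebra `D` over
the number field `K`, let `κ = u w u⁻¹ w⁻¹` be a non-central commutator of units of `D`
(`exists_commutator_units_not_central`) and `g = e_∞ ⊗ u + e_f ⊗ 1 ∈ (𝔸_K ⊗_K D)ˣ` (`e_∞`, `e_f`
the idempotents of `𝔸_K = K_∞ × 𝔸_K^∞`), `h = 1 ⊗ w`. Then `[g, h] = e_∞ ⊗ κ + e_f ⊗ 1` does not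
lie in `ℝ_{>0} · Dˣ`: an identity `e_∞ ⊗ κ + e_f ⊗ 1 = r_t ⊗ γ` (`t > 0`, `γ ∈ Dˣ`) read in
coordinates gives `γ = 1` at the finite places and then `κ ∈ K` at the infinite ones. [folklore] -/
theorem exists_commutator_not_mem_quotientSubgroup_units (hdiv : ∀ x : D, x ≠ 0 → IsUnit x) :
    ∃ g h : (AdelicGroupData.units K D).Adelic,
      g * h * g⁻¹ * h⁻¹ ∉ (AdelicGroupData.units K D).quotientSubgroup := by
  classical
  have h4 := IsQuaternionAlgebra.finrank_eq_four (K := K) (D := D)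
  haveI : Nontrivial D := Module.nontrivial_of_finrank_pos (R := K) (by omega)
  obtain ⟨x, y, hxy⟩ := IsQuaternionAlgebra.exists_mul_ne_mul K (D := D)
  obtain ⟨u, w, z₀, hz₀⟩ := exists_commutator_units_not_central hdiv hxy
  set κ : Dˣ := u * w * u⁻¹ * w⁻¹ with hκ
  have hκval : (κ : D) = (u : D) * w * ↑u⁻¹ * ↑w⁻¹ := by rw [hκ]; push_cast; rfl
  -- the idempotents of `𝔸_K = K_∞ × 𝔸_K^∞`
  set ei : AdeleRing (𝓞 K) K := (1, 0) with hei
  set ef : AdeleRing (𝓞 K) K := (0, 1) with hef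
  have hii : ei * ei = ei := Prod.ext (mul_one _) (mul_zero _)
  have hff : ef * ef = ef := Prod.ext (mul_zero _) (mul_one _)
  have hif : ei * ef = 0 := Prod.ext (mul_zero _) (zero_mul _)
  have hfi : ef * ei = 0 := Prod.ext (zero_mul _) (mul_zero _)
  have hsum : ei + ef = 1 := Prod.ext (add_zero _) (zero_add _)
  have hE : ∀ d : D, (1 : AdeleRing (𝓞 K) K) ⊗ₜ[K] d = ei ⊗ₜ[K] d + ef ⊗ₜ[K] d := fun d ↦ by
    rw [← TensorProduct.add_tmul, hsum]
  have hone : ei ⊗ₜ[K] (1 : D) + ef ⊗ₜ[K] (1 : D) = 1 := by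
    rw [← hE, Algebra.TensorProduct.one_def]
  -- multiplication of the elements `e_∞ ⊗ a + e_f ⊗ b`
  have key : ∀ a b a' b' : D,
      (ei ⊗ₜ[K] a + ef ⊗ₜ[K] b) * (ei ⊗ₜ[K] a' + ef ⊗ₜ[K] b') =
        ei ⊗ₜ[K] (a * a') + ef ⊗ₜ[K] (b * b') := fun a b a' b' ↦ by
    rw [add_mul, mul_add, mul_add, Algebra.TensorProduct.tmul_mul_tmul,
      Algebra.TensorProduct.tmul_mul_tmul, Algebra.TensorProduct.tmul_mul_tmul,
      Algebra.TensorProduct.tmul_mul_tmul, hii, hff, hif, hfi, TensorProduct.zero_tmul,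
      TensorProduct.zero_tmul, add_zero, zero_add]
  -- the unit `g = e_∞ ⊗ u + e_f ⊗ 1`
  set G : AdeleRing (𝓞 K) K ⊗[K] D := ei ⊗ₜ[K] (u : D) + ef ⊗ₜ[K] (1 : D) with hG
  set G' : AdeleRing (𝓞 K) K ⊗[K] D := ei ⊗ₜ[K] ((u⁻¹ : Dˣ) : D) + ef ⊗ₜ[K] (1 : D) with hG'
  have hGG' : G * G' = 1 := by rw [hG, hG', key, Units.mul_inv, mul_one, hone]
  have hG'G : G' * G = 1 := by rw [hG, hG', key, Units.inv_mul, mul_one, hone]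
  let g : (AdelicGroupData.units K D).Adelic :=
    (⟨ScalarExtension.ofTensor K _ D G, ScalarExtension.ofTensor K _ D G',
      by rw [← map_mul, hGG', map_one], by rw [← map_mul, hG'G, map_one]⟩ : adelicUnits K D)
  let h : (AdelicGroupData.units K D).Adelic := (inclAdelic K D w : adelicUnits K D)
  refine ⟨g, h, fun hmem ↦ hz₀ ?_⟩
  -- the commutator is `e_∞ ⊗ κ + e_f ⊗ 1`
  have hcomm : Units.val (g * h * g⁻¹ * h⁻¹) =
      ScalarExtension.ofTensor K _ D (ei ⊗ₜ[K] (κ : D) + ef ⊗ₜ[K] (1 : D)) := by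
    have hval : Units.val (g * h * g⁻¹ * h⁻¹) =
        ScalarExtension.ofTensor K _ D (G * ((1 : AdeleRing (𝓞 K) K) ⊗ₜ[K] (w : D)) * G' *
          ((1 : AdeleRing (𝓞 K) K) ⊗ₜ[K] ((w⁻¹ : Dˣ) : D))) := by
      rw [map_mul, map_mul, map_mul]
      rfl
    rw [hval, hG, hG', hE (w : D), hE ((w⁻¹ : Dˣ) : D), key, key, key, one_mul, mul_one,
      Units.mul_inv, hκval]
  -- membership in `ℝ_{>0} · Dˣ`: `[g, h] = r_t ⊗ γ`
  haveI hN : ((AdelicGroupData.units K D).center').Normal := ⟨fun n hn k ↦ by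
    have hc := Subgroup.mem_center_iff.mp ((AdelicGroupData.units K D).center'_le hn) k
    rw [hc, mul_inv_cancel_right]
    exact hn⟩
  obtain ⟨n, hn, γ', hγ', hprod⟩ := (Subgroup.mem_sup_of_normal_left (hs := hN)).1 hmem
  obtain ⟨t, rfl⟩ : ∃ t : ℝ≥0ˣ, posRealCentral K D t = n := MonoidHom.mem_range.mp hn
  obtain ⟨γ, rfl⟩ : ∃ γ : Dˣ, inclAdelic K D γ = γ' := MonoidHom.mem_range.mp hγ'
  set r : AdeleRing (𝓞 K) K := ((posRealIdele K t : (AdeleRing (𝓞 K) K)ˣ) : AdeleRing (𝓞 K) K)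
    with hr
  have hEQ : ScalarExtension.ofTensor K _ D (r ⊗ₜ[K] (γ : D)) =
      ScalarExtension.ofTensor K _ D (ei ⊗ₜ[K] (κ : D) + ef ⊗ₜ[K] (1 : D)) := by
    rw [← hcomm, ← hprod]
    change _ = ScalarExtension.ofTensor K _ D (r ⊗ₜ[K] (1 : D)) *
      ScalarExtension.ofTensor K _ D ((1 : AdeleRing (𝓞 K) K) ⊗ₜ[K] (γ : D))
    rw [← map_mul, Algebra.TensorProduct.tmul_mul_tmul, mul_one, one_mul]
  -- read `hEQ` in coordinates
  have hcoord : ∀ i, r * algebraMap K (AdeleRing (𝓞 K) K) ((Module.finBasis K D).repr (γ : D) i) =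
      ei * algebraMap K (AdeleRing (𝓞 K) K) ((Module.finBasis K D).repr (κ : D) i) +
        ef * algebraMap K (AdeleRing (𝓞 K) K) ((Module.finBasis K D).repr (1 : D) i) := by
    intro i
    have hc := congrArg (fun X ↦ ScalarExtension.coordLinearEquiv K (AdeleRing (𝓞 K) K) D X i) hEQ
    simp only [map_add, Pi.add_apply, ScalarExtension.coordLinearEquiv_ofTensor_tmul] at hc
    exact hc
  -- finite places: `γ_i = 1_i`
  have snd_mul' : ∀ a b : AdeleRing (𝓞 K) K, (a * b).2 = a.2 * b.2 := fun _ _ ↦ rfl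
  have snd_add' : ∀ a b : AdeleRing (𝓞 K) K, (a + b).2 = a.2 + b.2 := fun _ _ ↦ rfl
  have fst_mul' : ∀ a b : AdeleRing (𝓞 K) K, (a * b).1 = a.1 * b.1 := fun _ _ ↦ rfl
  have fst_add' : ∀ a b : AdeleRing (𝓞 K) K, (a + b).1 = a.1 + b.1 := fun _ _ ↦ rfl
  have hr2 : r.2 = 1 := by rw [hr, posRealIdele_snd]
  haveI := infinite_heightOneSpectrum K
  obtain ⟨v₀⟩ := (inferInstance : Nonempty (HeightOneSpectrum (𝓞 K)))
  have hfin : ∀ i, (Module.finBasis K D).repr (γ : D) i = (Module.finBasis K D).repr (1 : D) i := by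
    intro i
    have hc := congrArg Prod.snd (hcoord i)
    rw [snd_mul', snd_add', snd_mul', snd_mul', hr2, one_mul, hei, hef] at hc
    dsimp only at hc
    rw [zero_mul, one_mul, zero_add] at hc
    have hc2 := congrArg (fun a : FiniteAdeleRing (𝓞 K) K ↦ a v₀) hc
    simp only [AdeleRing.algebraMap_snd_apply] at hc2
    exact (algebraMap K (v₀.adicCompletion K)).injective hc2
  -- infinite places: `κ_i = ρ · 1_i` with `ρ = r_∞`
  have hinf : ∀ i, algebraMap K (InfiniteAdeleRing K) ((Module.finBasis K D).repr (κ : D) i) =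
      r.1 * algebraMap K (InfiniteAdeleRing K) ((Module.finBasis K D).repr (1 : D) i) := by
    intro i
    have hc := congrArg Prod.fst (hcoord i)
    rw [fst_mul', fst_add', fst_mul', fst_mul', hei, hef, hfin i] at hc
    dsimp only at hc
    rw [one_mul, zero_mul, add_zero] at hc
    exact hc.symm
  -- some coordinate of `1 ∈ D` is non-zero
  obtain ⟨i₀, hi₀⟩ : ∃ i₀, (Module.finBasis K D).repr (1 : D) i₀ ≠ 0 := by
    by_contra hall
    push Not at hall
    apply one_ne_zero (α := D)
    apply (Module.finBasis K D).repr.injective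
    rw [map_zero]
    ext i
    exact hall i
  set q : K := (Module.finBasis K D).repr (κ : D) i₀ * ((Module.finBasis K D).repr (1 : D) i₀)⁻¹
    with hq
  have hunit : IsUnit (algebraMap K (InfiniteAdeleRing K) ((Module.finBasis K D).repr (1 : D) i₀)) :=
    (Ne.isUnit hi₀).map _
  have hρ : r.1 = algebraMap K (InfiniteAdeleRing K) q := by
    have h0 := hinf i₀
    have h1 : algebraMap K (InfiniteAdeleRing K) ((Module.finBasis K D).repr (κ : D) i₀) =
        algebraMap K (InfiniteAdeleRing K) q *
          algebraMap K (InfiniteAdeleRing K) ((Module.finBasis K D).repr (1 : D) i₀) := by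
      rw [← map_mul, hq, inv_mul_cancel_right₀ hi₀]
    rw [h1] at h0
    exact (hunit.mul_left_inj.1 h0).symm
  have hκq : ∀ i, (Module.finBasis K D).repr (κ : D) i = q * (Module.finBasis K D).repr (1 : D) i :=
    fun i ↦ by
    apply (algebraMap K (InfiniteAdeleRing K)).injective
    rw [map_mul, ← hρ]
    exact hinf i
  have hκK : (κ : D) = algebraMap K D q := by
    rw [Algebra.algebraMap_eq_smul_one]
    apply (Module.finBasis K D).repr.injective
    rw [map_smul]
    ext i
    rw [Finsupp.smul_apply, smul_eq_mul]
    exact hκq i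
  rw [hκK]
  exact (Algebra.commutes q z₀).symm

end Adelic

section Analytic

variable {K : Type} [Field K] [NumberField K]

/-- If a representation of `G` on a normed space is the closed span of **one-dimensional**
closed invariant subspaces, then all its operators commute: on a line `ℂ f₀` each `π g` is a
scalar, and the closed subspace where `π g π h = π h π g` contains all these lines. [folklore] -/
theorem ContRepresentation.commute_of_isDiscretelyDecomposable_of_finrank_eq_one {G V : Type*}
    [Group G] [NormedAddCommGroup V] [NormedSpace ℂ V] (π : ContRepresentation ℂ G V)
    (hd : π.IsDiscretelyDecomposable)
    (h1 : ∀ W : ContRepresentation.ClosedSubrep π, W.toContRep.IsTopIrreducible →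
      Module.finrank ℂ W.toSubmodule = 1)
    (g h : G) : π g * π h = π h * π g := by
  set T : V →L[ℂ] V := π g * π h - π h * π g with hT
  suffices hker : LinearMap.ker (T : V →ₗ[ℂ] V) = ⊤ by
    have h0 : T = 0 := by
      ext v
      have hv : v ∈ LinearMap.ker (T : V →ₗ[ℂ] V) := hker ▸ Submodule.mem_top
      simpa using hv
    exact sub_eq_zero.1 h0
  rw [eq_top_iff]
  have htop : (π.discretePart).toSubmodule = ⊤ := by
    rw [show π.discretePart = ⊤ from hd]
    rfl
  rw [← htop]
  change (⨆ W ∈ {W : ContRepresentation.ClosedSubrep π | W.toContRep.IsTopIrreducible},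
    W.toSubmodule).topologicalClosure ≤ _
  refine Submodule.topologicalClosure_minimal _ (iSup₂_le fun W hW ↦ ?_) (T.isClosed_ker)
  intro v hv
  obtain ⟨f₀, -, hspan⟩ := finrank_eq_one_iff'.1 (h1 W hW)
  -- every `π k` acts on the line `W = ℂ f₀` by a scalar
  have hscal : ∀ k : G, ∃ a : ℂ, π k (f₀ : V) = a • (f₀ : V) := fun k ↦ by
    obtain ⟨a, ha⟩ := hspan ⟨π k (f₀ : V), W.apply_mem k f₀.2⟩
    exact ⟨a, by simpa using congrArg Subtype.val ha.symm⟩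
  obtain ⟨b, hb⟩ := hspan ⟨v, hv⟩
  have hvb : v = b • (f₀ : V) := by simpa using congrArg Subtype.val hb.symm
  obtain ⟨ag, hag⟩ := hscal g
  obtain ⟨ah, hah⟩ := hscal h
  have e1 : π g (π h v) = (b * ah * ag) • (f₀ : V) := by
    rw [hvb, map_smul, hah, map_smul, map_smul, hag, smul_smul, smul_smul]
  have e2 : π h (π g v) = (b * ag * ah) • (f₀ : V) := by
    rw [hvb, map_smul, hag, map_smul, map_smul, hah, smul_smul, smul_smul]
  rw [LinearMap.mem_ker]
  change π g (π h v) - π h (π g v) = 0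
  rw [e1, e2, mul_right_comm b ah ag, sub_self]

namespace AdelicGroupData

variable (𝒢 : AdelicGroupData.{u} K) (μ : Measure 𝒢.automorphicQuotient) [𝒢.IsAutomorphicMeasure μ]

/-- If `L²(G(𝔸_K) ⧸ A_G G(K))` is the closed span of one-dimensional closed invariant subspaces,
every commutator of `G(𝔸_K)` acts trivially on it. [folklore] -/
theorem rightRegular_commutator_eq_one (hd : (𝒢.rightRegular μ).IsDiscretelyDecomposable)
    (h1 : ∀ P : DiscreteAutomorphicRep 𝒢 μ, P.IsOneDimensional) (g h : 𝒢.Adelic) :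
    𝒢.rightRegular μ (g * h * g⁻¹ * h⁻¹) = 1 := by
  have hc := ContRepresentation.commute_of_isDiscretelyDecomposable_of_finrank_eq_one
    (𝒢.rightRegular μ) hd (fun W hW ↦ h1 ⟨W, hW⟩) g h
  have hgh : g * h * g⁻¹ * h⁻¹ = (g * h) * (h * g)⁻¹ := by group
  rw [hgh, map_mul, map_mul (𝒢.rightRegular μ) g h, hc, ← map_mul, ← map_mul, mul_inv_cancel,
    map_one]

/-- On a compact Hausdorff automorphic quotient, an element of `G(𝔸_K)` acting trivially on `L²`
fixes every point: otherwise a Urysohn function separating `x` from `c • x` is a continuous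
`L²`-function moved by `c` (an automorphic measure charges open sets, so a.e. equality of
continuous functions is equality, Mathlib `Continuous.ae_eq_iff_eq`). [folklore] -/
theorem smul_eq_self_of_rightRegular_eq_one [CompactSpace 𝒢.automorphicQuotient]
    [T2Space 𝒢.automorphicQuotient] {c : 𝒢.Adelic} (hc : 𝒢.rightRegular μ c = 1)
    (x : 𝒢.automorphicQuotient) : c • x = x := by
  by_contra hx
  obtain ⟨φ, hφ0, hφ1, -⟩ := exists_continuous_zero_one_of_isClosed
    (isClosed_singleton (x := c • x)) (isClosed_singleton (x := x))
    (Set.disjoint_singleton.2 hx)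
  set ψ : 𝒢.automorphicQuotient → ℂ := fun y ↦ ((φ y : ℝ) : ℂ) with hψ
  have hψc : Continuous ψ := Complex.continuous_ofReal.comp φ.continuous
  have hψm : MemLp ψ 2 μ := by
    refine MemLp.of_bound hψc.aestronglyMeasurable ‖φ‖ (Filter.Eventually.of_forall fun y ↦ ?_)
    rw [hψ]
    dsimp only
    rw [Complex.norm_real]
    exact φ.norm_coe_le_norm y
  set f : 𝒢.L2 μ := hψm.toLp ψ with hf
  have h1 : ((𝒢.rightRegular μ c f : 𝒢.L2 μ) : 𝒢.automorphicQuotient → ℂ) =ᵐ[μ]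
      fun y ↦ f (c⁻¹ • y) := 𝒢.rightRegular_apply_coeFn μ c f
  rw [hc] at h1
  change (f : 𝒢.automorphicQuotient → ℂ) =ᵐ[μ] fun y ↦ f (c⁻¹ • y) at h1
  have h2 : (fun y ↦ f (c⁻¹ • y)) =ᵐ[μ] fun y ↦ ψ (c⁻¹ • y) :=
    (measurePreserving_smul c⁻¹ μ).quasiMeasurePreserving.ae_eq_comp hψm.coeFn_toLp
  have h3 : ψ =ᵐ[μ] fun y ↦ ψ (c⁻¹ • y) := (hψm.coeFn_toLp.symm.trans h1).trans h2
  have h4 : ψ = fun y ↦ ψ (c⁻¹ • y) :=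
    (Continuous.ae_eq_iff_eq μ hψc (hψc.comp (continuous_const_smul _))).1 h3
  have h5 := congrFun h4 (c • x)
  simp only [hψ, inv_smul_smul, Complex.ofReal_inj] at h5
  rw [hφ0 (Set.mem_singleton _), hφ1 (Set.mem_singleton _)] at h5
  exact zero_ne_one h5

end AdelicGroupData

end Analytic

section NotOneDimensional

variable (K : Type) [Field K] [NumberField K] (D : Type u) [Ring D] [Algebra K D]
  [IsQuaternionAlgebra K D]

/-- **A division quaternion algebra has an automorphic representation of dimension `≠ 1`**
(non-vacuity of the hypothesis of the Jacquet–Langlands transfer; Gelbart (1975), §10, p. 149: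
the "greater than one dimensional" constituents of `R'`). For `D` division and `μ` an automorphic
measure on the compact quotient `D_𝔸ˣ ⧸ ℝ_{>0} Dˣ` (Fujisaki), some irreducible closed invariant
subspace of `L²` is not a line. Otherwise, `L²` being the closed span of its irreducible closed
subspaces (`isDiscretelyDecomposable_rightRegular_units`, Gelfand–Graev–Piatetski-Shapiro), every
commutator of `D_𝔸ˣ` would act trivially on `L²` (`rightRegular_commutator_eq_one`), hence on the
compact Hausdorff quotient (`smul_eq_self_of_rightRegular_eq_one`), hence would lie in
`ℝ_{>0} · Dˣ` — contradicting `exists_commutator_not_mem_quotientSubgroup_units`.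
[cite: Gelbart1975, Thm. 10.5 (i)] -/
theorem exists_discreteAutomorphicRep_not_isOneDimensional (hdiv : ∀ x : D, x ≠ 0 → IsUnit x)
    (μ : Measure (AdelicGroupData.units K D).automorphicQuotient)
    [(AdelicGroupData.units K D).IsAutomorphicMeasure μ] :
    ∃ P : DiscreteAutomorphicRep (AdelicGroupData.units K D) μ, ¬ P.IsOneDimensional := by
  by_contra hall
  push Not at hall
  have h4 := IsQuaternionAlgebra.finrank_eq_four (K := K) (D := D)
  haveI : Nontrivial D := Module.nontrivial_of_finrank_pos (R := K) (by omega)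
  haveI : CompactSpace (AdelicGroupData.units K D).automorphicQuotient :=
    AdelicGroupData.compactSpace_automorphicQuotient_units_holds K D hdiv
  haveI : IsClosed (((AdelicGroupData.units K D).quotientSubgroup :
      Subgroup (AdelicGroupData.units K D).Adelic) : Set (AdelicGroupData.units K D).Adelic) :=
    AdelicGroupData.isClosed_quotientSubgroup_units K D
  haveI : T2Space (AdelicGroupData.units K D).automorphicQuotient :=
    inferInstanceAs (T2Space ((AdelicGroupData.units K D).Adelic ⧸
      (AdelicGroupData.units K D).quotientSubgroup))
  obtain ⟨g, h, hgh⟩ := exists_commutator_not_mem_quotientSubgroup_units K D hdiv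
  apply hgh
  have hd := AdelicGroupData.isDiscretelyDecomposable_rightRegular_units K D hdiv μ
  have hc := AdelicGroupData.rightRegular_commutator_eq_one (AdelicGroupData.units K D) μ hd hall
    g h
  have key := AdelicGroupData.smul_eq_self_of_rightRegular_eq_one (AdelicGroupData.units K D) μ hc
    ((AdelicGroupData.units K D).toAutomorphicQuotient 1)
  have key' : (QuotientGroup.mk ((g * h * g⁻¹ * h⁻¹) * 1) :
      (AdelicGroupData.units K D).Adelic ⧸ (AdelicGroupData.units K D).quotientSubgroup) =
      QuotientGroup.mk 1 := key
  rw [mul_one, QuotientGroup.eq, mul_one] at key'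
  exact (Subgroup.inv_mem_iff _).1 key'

end NotOneDimensional

/-! ### 3. Assembly: the Jacquet–Langlands transfer yields cusp forms on `GL₂` over every number field -/

section Assembly

/-- **Cusp forms on `GL₂(𝔸_F)` exist for every number field `F`, granted the Jacquet–Langlands
transfer** (Gelbart (1975), Thm. 10.5 (i); Jacquet–Langlands (1970), Thm. 14.4): the named fact
`nonempty_cuspidalAutomorphicRepData_two` (Gelbart, Thm. 7.11, there proved through theta series /
the converse theorem) follows from the tree's named fact `jacquetLanglands_transfer_exists K D`
(`JacquetLanglandsParts`) for all number fields `K` and division quaternion algebras `D`. Proof: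
`F` carries a division quaternion algebra `D` (`exists_isQuaternionAlgebra_forall_isUnit`); its
compact automorphic quotient carries an automorphic measure
(`exists_isAutomorphicMeasure_units_of_isUnit`) and an automorphic representation `πD` of dimension
`≠ 1` (`exists_discreteAutomorphicRep_not_isOneDimensional`); the transfer of `πD` is a cuspidal
`π ≤ L²_cusp(GL₂(𝔸_F) ⧸ A_G GL₂(F), μ)` for an automorphic `μ`
(`exists_isAutomorphicMeasure_gl_holds`), whose smooth vectors give a cuspidal automorphic
representation datum (`CuspidalAutomorphicRepData.ofL2`, Borel–Jacquet 4.6). This is how Gelbart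
(pp. 157–158) obtains cusp forms from the compact quotient. [cite: Gelbart1975, Thm. 10.5 (i)] -/
theorem nonempty_cuspidalAutomorphicRepData_two_of_jacquetLanglands
    (hJL : ∀ (K : Type) [Field K] [NumberField K] (D : Type) [Ring D] [Algebra K D]
      [IsQuaternionAlgebra K D], jacquetLanglands_transfer_exists K D) :
    nonempty_cuspidalAutomorphicRepData_two := by
  intro F _ _ hF
  obtain ⟨D, _, _, hQ, hdiv⟩ := exists_isQuaternionAlgebra_forall_isUnit F
  haveI := hQ
  obtain ⟨μD, hμD⟩ := AdelicGroupData.exists_isAutomorphicMeasure_units_of_isUnit F D hdiv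
  haveI := hμD
  obtain ⟨μ, hμ⟩ := AdelicGroupData.exists_isAutomorphicMeasure_gl_holds 2 F
  haveI := hμ
  obtain ⟨πD, hπD⟩ := exists_discreteAutomorphicRep_not_isOneDimensional F D hdiv μD
  letI : ∀ v : HeightOneSpectrum (𝓞 F), MeasurableSpace (GL (Fin 2) (v.adicCompletion F) ⧸
      Subgroup.center (GL (Fin 2) (v.adicCompletion F))) := fun v ↦ borel _
  haveI : ∀ v : HeightOneSpectrum (𝓞 F), BorelSpace (GL (Fin 2) (v.adicCompletion F) ⧸
      Subgroup.center (GL (Fin 2) (v.adicCompletion F))) := fun v ↦ ⟨rfl⟩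
  obtain ⟨π, -, -⟩ := hJL F D hdiv μD μ πD hπD
  exact ⟨CuspidalAutomorphicRepData.ofL2 hF π⟩

end Assembly

end Literature.NumberTheory.Automorphic

end
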